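import Summits.CriticalPhenomena.PercolationContinuityZ3.Theorems.Transplant.SkelPhiFaceNumsYx2V
import Summits.CriticalPhenomena.PercolationContinuityZ3.Theorems.Transplant.SkelPhiFaceNumsX2
import Summits.CriticalPhenomena.PercolationContinuityZ3.Theorems.Transplant.SkelNegBParamsFoot
import Summits.CriticalPhenomena.PercolationContinuityZ3.Theorems.Transplant.SkelPhiFaceCellReadV
import Summits.CriticalPhenomena.PercolationContinuityZ3.Theorems.Transplant.SkelPhiFaceCellRead
import Summits.CriticalPhenomena.PercolationContinuityZ3.Theorems.Transplant.SkelPhiFaceRunNV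
import Summits.CriticalPhenomena.PercolationContinuityZ3.Theorems.Transplant.SkelPhiFaceRunN
import Summits.CriticalPhenomena.PercolationContinuityZ3.Theorems.Transplant.SkelPhiFaceNumsXP2
import Literature.Probability.Percolation.OrientedHistorySiteRenormalizationRun
import Summits.CriticalPhenomena.PercolationContinuityZ3.Theorems.Transplant.SkelPhiFaceDataNV
import Summits.CriticalPhenomena.PercolationContinuityZ3.Theorems.Transplant.SkelPhiFaceTargetMM2V
import Summits.CriticalPhenomena.PercolationContinuityZ3.Theorems.Transplant.PlanarCells2VDefs
import HarnessLib
import Summits.CriticalPhenomena.PercolationContinuityZ3.Theorems.Transplant.SkelFrmFromBParamsFaceFloorsPinSYA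
import Summits.CriticalPhenomena.PercolationContinuityZ3.Theorems.Transplant.SkelFrmBParamsFaceFloorsPinSYA
import Summits.CriticalPhenomena.PercolationContinuityZ3.Theorems.Transplant.SkelFrmFromBParamsFaceFloorsLAdYA
import Summits.CriticalPhenomena.PercolationContinuityZ3.Theorems.Transplant.SkelFrmBParamsFaceFloorsLAdYA
import Summits.CriticalPhenomena.PercolationContinuityZ3.Theorems.Transplant.SkelFrmFromBParamsFaceOriginsYLA
import Summits.CriticalPhenomena.PercolationContinuityZ3.Theorems.Transplant.SkelFrmBParamsFaceOriginsYLA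
import Summits.CriticalPhenomena.PercolationContinuityZ3.Theorems.Transplant.SkelFrmFromBParamsFaceOriginsXA
import Summits.CriticalPhenomena.PercolationContinuityZ3.Theorems.Transplant.SkelFrmBParamsFaceOriginsXA
import Summits.CriticalPhenomena.PercolationContinuityZ3.Theorems.Transplant.SkelFrmFromBParamsFaceOriginsYA
import Summits.CriticalPhenomena.PercolationContinuityZ3.Theorems.Transplant.SkelFrmBParamsFaceOriginsYA
import Summits.CriticalPhenomena.PercolationContinuityZ3.Theorems.Transplant.SkelFrmFromBParamsFramesF
import Summits.CriticalPhenomena.PercolationContinuityZ3.Theorems.Transplant.SkelFrmBParamsFramesF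
import Summits.CriticalPhenomena.PercolationContinuityZ3.Theorems.Transplant.SkelFrmFromBParamsFaceFloorsClrYF
import Summits.CriticalPhenomena.PercolationContinuityZ3.Theorems.Transplant.SkelFrmBParamsFaceFloorsClrYF
import Summits.CriticalPhenomena.PercolationContinuityZ3.Theorems.Transplant.SkelFrmFromBParamsFaceFloorsClrYA
import Summits.CriticalPhenomena.PercolationContinuityZ3.Theorems.Transplant.SkelFrmBParamsFaceFloorsClrYA
import Summits.CriticalPhenomena.PercolationContinuityZ3.Theorems.Transplant.SkelFrmFromBParamsFaceFloorsFAYA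
import Summits.CriticalPhenomena.PercolationContinuityZ3.Theorems.Transplant.SkelFrmBParamsFaceFloorsFAYA
import Summits.CriticalPhenomena.PercolationContinuityZ3.Theorems.Transplant.SkelFrmFromBParamsFaceFloorsFBYA
import Summits.CriticalPhenomena.PercolationContinuityZ3.Theorems.Transplant.SkelFrmBParamsFaceFloorsFBYA
import Summits.CriticalPhenomena.PercolationContinuityZ3.Theorems.Transplant.SkelFrmFromBParamsFaceFloorsFTYA
import Summits.CriticalPhenomena.PercolationContinuityZ3.Theorems.Transplant.SkelFrmBParamsFaceFloorsFTYA
import Summits.CriticalPhenomena.PercolationContinuityZ3.Theorems.Transplant.SkelFrmFromBParamsFaceFloorsLYA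
import Summits.CriticalPhenomena.PercolationContinuityZ3.Theorems.Transplant.SkelFrmBParamsFaceFloorsLYA
import Summits.CriticalPhenomena.PercolationContinuityZ3.Theorems.Transplant.SkelFrmFromBParamsFaceFloorsQYA
import Summits.CriticalPhenomena.PercolationContinuityZ3.Theorems.Transplant.SkelFrmBParamsFaceFloorsQYA
import Summits.CriticalPhenomena.PercolationContinuityZ3.Theorems.Transplant.SkelFrmFromBParamsFaceFloorsZPiYA
import Summits.CriticalPhenomena.PercolationContinuityZ3.Theorems.Transplant.SkelFrmBParamsFaceFloorsZPiYA
import Summits.CriticalPhenomena.PercolationContinuityZ3.Theorems.Transplant.SkelFrmFromBParamsFaceFloorsZYA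
import Summits.CriticalPhenomena.PercolationContinuityZ3.Theorems.Transplant.SkelFrmBParamsFaceFloorsZYA
import Summits.CriticalPhenomena.PercolationContinuityZ3.Theorems.Transplant.SkelFrmFromBParamsFaceFloorsPinYA
import Summits.CriticalPhenomena.PercolationContinuityZ3.Theorems.Transplant.SkelFrmBParamsFaceFloorsPinYA
import Summits.CriticalPhenomena.PercolationContinuityZ3.Theorems.Transplant.SkelFrmFromBParamsFaceCountsYA
import Summits.CriticalPhenomena.PercolationContinuityZ3.Theorems.Transplant.SkelFrmBParamsFaceCountsYA
import Summits.CriticalPhenomena.PercolationContinuityZ3.Theorems.Transplant.SkelFrmFromBParamsFaceCountsRangeYA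
import Summits.CriticalPhenomena.PercolationContinuityZ3.Theorems.Transplant.SkelFrmBParamsFaceCountsRangeYA
import Summits.CriticalPhenomena.PercolationContinuityZ3.Theorems.Transplant.SkelFrmFromBParamsFaceCountsShiftYA
import Summits.CriticalPhenomena.PercolationContinuityZ3.Theorems.Transplant.SkelFrmBParamsFaceCountsShiftYA
import Summits.CriticalPhenomena.PercolationContinuityZ3.Theorems.Transplant.SkelPhiFaceNumsYP2T
import Summits.CriticalPhenomena.PercolationContinuityZ3.Theorems.Transplant.SkelFrmFromBChoiceWindow
import Summits.CriticalPhenomena.PercolationContinuityZ3.Theorems.Transplant.SkelFrmBChoiceWindow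
import Summits.CriticalPhenomena.PercolationContinuityZ3.Theorems.Transplant.PlanarSkeletonFrmFromDefs
import Summits.CriticalPhenomena.PercolationContinuityZ3.Theorems.Transplant.PlanarSkeletonFrmDefs
import Summits.CriticalPhenomena.PercolationContinuityZ3.Theorems.Transplant.SkelPhiStepIDataNS
import Summits.CriticalPhenomena.PercolationContinuityZ3.Theorems.Transplant.SkelFrmFromBParamsFaceFloorsY2SA
import Summits.CriticalPhenomena.PercolationContinuityZ3.Theorems.Transplant.SkelFrmBParamsFaceFloorsY2SA
import Summits.CriticalPhenomena.PercolationContinuityZ3.Theorems.Transplant.SkelFrmFromBParamsFaceFloorsY2WB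
import Summits.CriticalPhenomena.PercolationContinuityZ3.Theorems.Transplant.SkelFrmBParamsFaceFloorsY2WB
import Summits.CriticalPhenomena.PercolationContinuityZ3.Theorems.Transplant.SkelFrmFromBParamsFaceFloorsYxG
import Summits.CriticalPhenomena.PercolationContinuityZ3.Theorems.Transplant.SkelFrmBParamsFaceFloorsYxG
import Summits.CriticalPhenomena.PercolationContinuityZ3.Theorems.Transplant.SkelFrmFromBParamsFaceFloorsYxH
import Summits.CriticalPhenomena.PercolationContinuityZ3.Theorems.Transplant.SkelFrmBParamsFaceFloorsYxH
import Summits.CriticalPhenomena.PercolationContinuityZ3.Theorems.Transplant.SkelFrmFromBParamsFaceFloorsX2WB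
import Summits.CriticalPhenomena.PercolationContinuityZ3.Theorems.Transplant.SkelFrmBParamsFaceFloorsX2WB
import Summits.CriticalPhenomena.PercolationContinuityZ3.Theorems.Transplant.SkelFrmBParamsFaceFloorsYxW
/-!
# U-WAVE PORT (RULING D-U, lead g21 2026-08-26; WAVE-U-MANIFEST v3.1 row «SkelFrmBParamsFaceFloorsYxW» ↦ «SkelFrmFromBParamsFaceFloorsYxW») of the tree module
# `Transplant/SkelFrmBParamsFaceFloorsYxW` onto the carrier `PlanarSkeletonFrmFrom` (frames only, cylinders connected from width `ℓ₀` on)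

ORIGINAL TITLE: N2 (frames-only node, OPEN) — (F) column, (R-49)(c2b): **THE PROVIDER OF THE X4-SHAPED NUMBERS AT y′-FACES** (`Skelφ.FloorsYx2V`, `Skelφ.numsYx_provider₂EV`; hp-8 g43; g44: count/sign-exposing provider THEOREM for the BVC wiring)

builds on p205010 (kernel theorem, internal audit signed; external expert review pending) — nothing in this file uses p205010; NOTHING is claimed about the
OPEN node U `SamePDropOfSkeletonFrmFrom₁` (nor U_s / the end state).  Lane `prim-bschramm`, seat `prim-bschramm-stmt` gen 26 (port pen, RULING M-11 family P-stmt; tool = p3-g26's port_u.py of record, registry-driven inputs); helper file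
(`--supports stmt-CriticalPhenomena-4575 --as helper`).  PORT RULES r1–r4 of RULING D-U: declaration order and proof texts are those of the original,
byte-identical except (i) the carrier token `PlanarSkeletonFrm ↦ PlanarSkeletonFrmFrom` (binders, `namespace`/`end` lines, qualified names of twinned
declarations), (ii) carrier-FREE declarations of the original (φ-level `Skelφ…` blocks and namespace-only arithmetic residents) are NOT re-declared —
this file imports the original and `export`s the twin-free residents (POLICY T / treatment (m1)); residents whose statement mentions a twinned
constant are copied, (iii) every carrier-binding declaration keeps its explicit binder `(Φ : PlanarSkeletonFrmFrom G)` in its own signature (r2).  Docstrings and citations are the original's.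
-/
noncomputable section

open scoped Classical

namespace Summit.CriticalPhenomena.PercolationContinuityZ3.Theorems.Transplant

namespace Skelφ

open Literature.Probability.Percolation Literature.Probability.LatticeModels SimpleGraph KNCells
open Literature.Probability.Percolation.KozmaNitzan
open Literature.Probability.Percolation.KozmaNitzan.Cells (oth oth_ne sgOf sgOf_sign stepVec_apply_fst eq_oth_of_ne oth_oth)
open KNLevels ChainPlanar ChainPara
open Literature.Barriers.CriticalPhenomena (graphBall mem_graphBall_self graphBall_mono)
open BoxProdZ2 (ConcRadiiG)
open TwoAxis.Para (modulus coarse lam0 lam1)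

variable {V : Type} [DecidableEq V] {G : SimpleGraph V} [G.LocallyFinite] {φ : V → Site 2}

end Skelφ

end Summit.CriticalPhenomena.PercolationContinuityZ3.Theorems.Transplant

end

/-!
# N2 (frames-only node, OPEN) — (F) column, (R-49)(c2b) VALUE LAYER part E4: **THE ASSEMBLY OF THE X4-SHAPED y′-FACE FLOORS** (hp-8 g43)

`KS.floorsYx2_YFsW : Skelφ.FloorsYx2V …` at the node tuple's cells (`P : PCells2V` with `P.toPCells2 = fcellsA`), for an ONWARD y′-face
step (`du.1 = 1`, `sgOf du = 1`): origin = the x-face origin `yLXFs σ` (bridge `BFs σ`, window `qBXFs = R'0`), prefix count `KS.NxW`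
(read at `yTX0 yLXFs σ`, window `bwY`), junction `KS.yTYx`, second run window `qB3XA R'0`, along count `NrY` at the junction, arrival box
`small3`, radius `πBudX`. Every field is a part A–E3 lemma or a verbatim x-face / y′-face chain lemma: hfR/hZfar (`hfR_YA`, `hZfar_YW`), FX
(`floorsFX_Yx` ∘ `tanYx_pos`), FY (`FYlo_Yx/FYhi_Yx/FWlo_Yx/FWhi_Yx` ∘ `juncYx_F1cA/juncYx_pos`, `NrY_spec`), FL (`FL1_Yx/FL2_Yx` ∘
`juncYx_window`, `FL3_XW/FL4_XW` ∘ `juncYx_levelwin`), hfit/hq₃/hclr (`hfit_Yx/hq₃_Yx/hclr_Yx`), hxaX/hxbX (`hxaXF_s/hxbXF_s`), hclr₃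
(`clr₃_Yx`), hπ2X/hπ3X (`hπ2_Yx/hπ3_Yx`). KEPT HYPOTHESES (node rows, discharged by the glue/packager): the band rows `hkE/hkE8/hkE24`, the
start row `hTwx : 12·u₀ + 5 ≤ T0Y + bwY` (feasibility `ρ₀ + 19·s₀ + ε_y ≤ b₀`, p3-g18 16:24:11Z), `NX0 ≤ c`, `πBudX ≤ r`; NO sign hypothesis on `v_L`.
NON-VACUITY: instantiated by the glue `…YxHFW` and the (F) packager at the node tuple. builds on p205010 (kernel theorem, internal audit signed;
external expert review pending) — nothing here uses p205010; NOTHING is claimed about the open node `SamePDropOfSkeletonFrmFrom₁`.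
Lane `prim-bschramm`, seat `prim-hp-8` (gen 43); helper file (`--supports stmt-CriticalPhenomena-4575 --as helper`).
[cite: KozmaNitzan2024, §4 Lemma 11–12 (pp. 21–25), Theorem 6 (pp. 25–31)] [cite: MartineauTassion2017, §4.3]
-/

noncomputable section

open scoped Classical

namespace Summit.CriticalPhenomena.PercolationContinuityZ3.Theorems.Transplant

namespace PlanarSkeletonFrmFrom

namespace NegB

open Literature.Probability.Percolation Literature.Probability.LatticeModels SimpleGraph KNCells KNLevels
open Literature.Probability.Percolation.KozmaNitzan.Cells (oth sgOf sgOf_sign stepVec_apply_fst)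
open SkelConc (Consts)
open Skelφ (shearUnit shearUnit_pos yBoxLoS yBoxHiS ySLo ySHi yBnd xBoxB xSLo xSHi xBoxLoA xBoxHiA crossOffY yPrmW xCoreB xCSLo xCSHi)
open Skelφ.StepI (DataN)
open ChainPlanar (BridgePrm)
open TwoAxis.Para (modulus)
open Neg

namespace KS

set_option maxHeartbeats 4000000 in
/-- **THE X4-SHAPED y′-FACE FLOORS AT THE NODE** (one-sided; see the module docstring). [cite: KozmaNitzan2024, §4 Lemma 12 (pp. 23–25)] -/
theorem floorsYx2_YFsW (κ : Consts) {V : Type} [DecidableEq V] [Countable V] {G : SimpleGraph V} [G.LocallyFinite] (Φ : PlanarSkeletonFrmFrom G) (t : V) (p : unitInterval) (D : Skelφ.StepI.DataNS V) (c : ℕ) (mk : ℕ) (gx : Neg.FSlot) (fx : Neg.FSlot) (P : PCells2V) (hP : P.toPCells2 = fcellsA κ Φ t p D (gT mk gx κ Φ t p D) (fT mk fx κ Φ t p D))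
    (hN : EqNumL κ Φ t p D (gT mk gx κ Φ t p D) (fT mk fx κ Φ t p D)) (hκ : (hL κ Φ t p D (gT mk gx κ Φ t p D) (fT mk fx κ Φ t p D)).natAbs ≤ 10 * nL κ Φ t p D (gT mk gx κ Φ t p D) (fT mk fx κ Φ t p D))
    (hnA : 2000 * Neg.Kq κ * ((KS0.R'0 κ Φ t p D mk) + 2) ≤ nL κ Φ t p D (gT mk gx κ Φ t p D) (fT mk fx κ Φ t p D)) (hnA24 : 2400 * Neg.Kq κ * ((KS0.R'0 κ Φ t p D mk) + 2) ≤ nL κ Φ t p D (gT mk gx κ Φ t p D) (fT mk fx κ Φ t p D))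
    (hℓA : 22000 * Neg.Kq κ * ((KS0.R'0 κ Φ t p D mk) + 2) ≤ ℓL κ Φ t p D (gT mk gx κ Φ t p D) (fT mk fx κ Φ t p D))
    (hS : 16 * SF κ Φ t p D c mk ≤ ML κ Φ t p D (gT mk gx κ Φ t p D)) (hS64 : 64 * SF κ Φ t p D c mk ≤ ML κ Φ t p D (gT mk gx κ Φ t p D))
    (hMR0 : 22000 * ((KS0.R'0 κ Φ t p D mk) + 2) ≤ ML κ Φ t p D (gT mk gx κ Φ t p D)) (hRn0 : (KS0.R'0 κ Φ t p D mk) ≤ nL κ Φ t p D (gT mk gx κ Φ t p D) (fT mk fx κ Φ t p D))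
    (hs0 : 6 * ((KS0.R'0 κ Φ t p D mk) : ℤ) + 11 ≤ u₀A κ Φ t p D (gT mk gx κ Φ t p D) (fT mk fx κ Φ t p D)) (hs1 : 14 * ((KS0.R'0 κ Φ t p D mk) : ℤ) + 27 ≤ u₁A κ Φ t p D (gT mk gx κ Φ t p D) (fT mk fx κ Φ t p D))
    (hkF0 : kF₀A κ Φ t p D c mk (gT mk gx κ Φ t p D) (fT mk fx κ Φ t p D) ≤ 8 * u₀A κ Φ t p D (gT mk gx κ Φ t p D) (fT mk fx κ Φ t p D) + 1) (hkF1 : kF₁A κ Φ t p D c mk (gT mk gx κ Φ t p D) (fT mk fx κ Φ t p D) ≤ 8 * u₁A κ Φ t p D (gT mk gx κ Φ t p D) (fT mk fx κ Φ t p D) + 1)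
    (hc : NX0 ≤ c)
    (x : Site 2) (du : MDir) (hd : du.1 = 1) (hsg : sgOf du = 1) (j : ℕ) (hj : j < P.K) (z : Site 2) {E : ℕ} {kE : ℤ}
    (hlev1 : P.faceL 1 j - E ≤ P.lev du x z) (hlev2 : P.lev du x z ≤ P.faceL 1 j + E)
    (hz : |z 0 - P.cenS x 0| ≤ kE) (hEu : (E : ℤ) ≤ u₁A κ Φ t p D (gT mk gx κ Φ t p D) (fT mk fx κ Φ t p D)) (hE2 : (E : ℤ) ≤ 2 * ((KS0.R'0 κ Φ t p D mk) : ℤ))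
    (hkE : kE ≤ 5 * (P.r 0 : ℤ)) (hkE8 : kE + 8 * u₀A κ Φ t p D (gT mk gx κ Φ t p D) (fT mk fx κ Φ t p D) + 8 + P.c 1 ≤ 5 * (P.r 0 : ℤ))
    (hkE24 : 2 * kE + 24 * u₀A κ Φ t p D (gT mk gx κ Φ t p D) (fT mk fx κ Φ t p D) + 24 + 2 * (P.c 1 : ℤ) ≤ 5 * (P.r 0 : ℤ))
    (hTwx : 12 * u₀A κ Φ t p D (gT mk gx κ Φ t p D) (fT mk fx κ Φ t p D) + 5 ≤ T0Y P.toPCells2T x du z + ((bwY κ Φ t p D (gT mk gx κ Φ t p D) (fT mk fx κ Φ t p D)) : ℤ))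
    (r : ℕ) (hr : πBudX κ Φ t p D c mk (gT mk gx κ Φ t p D) (fT mk fx κ Φ t p D) ≤ r) :
    Skelφ.FloorsYx2V (prFA κ Φ t p D (gT mk gx κ Φ t p D) (fT mk fx κ Φ t p D)) (nL κ Φ t p D (gT mk gx κ Φ t p D) (fT mk fx κ Φ t p D)) (u₀A κ Φ t p D (gT mk gx κ Φ t p D) (fT mk fx κ Φ t p D)) (u₁A κ Φ t p D (gT mk gx κ Φ t p D) (fT mk fx κ Φ t p D)) (modulus (nL κ Φ t p D (gT mk gx κ Φ t p D) (fT mk fx κ Φ t p D)) (hL κ Φ t p D (gT mk gx κ Φ t p D) (fT mk fx κ Φ t p D)) (vL κ Φ t p D (gT mk gx κ Φ t p D) (fT mk fx κ Φ t p D)) (vβL κ Φ t p D (gT mk gx κ Φ t p D) (fT mk fx κ Φ t p D))) (nL κ Φ t p D (gT mk gx κ Φ t p D) (fT mk fx κ Φ t p D) : ℤ) (ℓL κ Φ t p D (gT mk gx κ Φ t p D) (fT mk fx κ Φ t p D))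
      P (NegB.BSlot.small3 κ Φ t p D (gT mk gx κ Φ t p D) (fT mk fx κ Φ t p D)) x du j 3 r (Mu D) z
      (fun i => if i = 0 then kF₀A κ Φ t p D c mk (gT mk gx κ Φ t p D) (fT mk fx κ Φ t p D) else kF₁A κ Φ t p D c mk (gT mk gx κ Φ t p D) (fT mk fx κ Φ t p D))
      (BFs κ Φ t p D c mk (gT mk gx κ Φ t p D) (fT mk fx κ Φ t p D) (sgOf du)) (KS0.R'0 κ Φ t p D mk) (qBXFs κ Φ t p D mk) (KS0.R'0 κ Φ t p D mk) (qB3XA κ Φ t p D (gT mk gx κ Φ t p D) (fT mk fx κ Φ t p D) (KS0.R'0 κ Φ t p D mk))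
      (yLXFs κ Φ t p D c mk (gT mk gx κ Φ t p D) (fT mk fx κ Φ t p D) (sgOf du)) (NxW κ Φ t p D (gT mk gx κ Φ t p D) (fT mk fx κ Φ t p D) P.toPCells2T (yLXFs κ Φ t p D c mk (gT mk gx κ Φ t p D) (fT mk fx κ Φ t p D) (sgOf du)) x du z (bwY κ Φ t p D (gT mk gx κ Φ t p D) (fT mk fx κ Φ t p D))) (NrY κ Φ t p D (gT mk gx κ Φ t p D) (fT mk fx κ Φ t p D) P.toPCells2T (yTYx κ Φ t p D (gT mk gx κ Φ t p D) (fT mk fx κ Φ t p D) P.toPCells2T (yLXFs κ Φ t p D c mk (gT mk gx κ Φ t p D) (fT mk fx κ Φ t p D) (sgOf du)) x du z (bwY κ Φ t p D (gT mk gx κ Φ t p D) (fT mk fx κ Φ t p D))) x du z) := by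
  have hσ : sgOf du = 1 ∨ sgOf du = -1 := sgOf_sign du
  have hm1' : sgOf du ≠ -1 := by rw [hsg]; norm_num
  have hP' : P.toPCells2T.toPCells2 = fcellsA κ Φ t p D (gT mk gx κ Φ t p D) (fT mk fx κ Φ t p D) := hP
  obtain ⟨hrP, hsP, -⟩ := cells_of_hP κ Φ t p D (gT mk gx κ Φ t p D) (fT mk fx κ Φ t p D) P.toPCells2T hP'
  have es0 : ((P.s 0 : ℕ) : ℤ) = u₀A κ Φ t p D (gT mk gx κ Φ t p D) (fT mk fx κ Φ t p D) := by rw [hsP 0]; rfl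
  have es1 : ((P.s 1 : ℕ) : ℤ) = u₁A κ Φ t p D (gT mk gx κ Φ t p D) (fT mk fx κ Φ t p D) := by rw [hsP 1]; rfl
  have hr1 : (P.r 1 : ℤ) = 40 * (Neg.Kq κ : ℤ) * u₁A κ Φ t p D (gT mk gx κ Φ t p D) (fT mk fx κ Φ t p D) := by rw [hrP 1]; exact (units_eqA κ Φ t p D (gT mk gx κ Φ t p D) (fT mk fx κ Φ t p D)).2.2.2.1
  have hu0 : 1 ≤ u₀A κ Φ t p D (gT mk gx κ Φ t p D) (fT mk fx κ Φ t p D) := (units_eqA κ Φ t p D (gT mk gx κ Φ t p D) (fT mk fx κ Φ t p D)).2.2.2.2.1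
  have hu1 : 1 ≤ u₁A κ Φ t p D (gT mk gx κ Φ t p D) (fT mk fx κ Φ t p D) := (units_eqA κ Φ t p D (gT mk gx κ Φ t p D) (fT mk fx κ Φ t p D)).2.2.2.2.2
  have hKq : (1 : ℤ) ≤ (Neg.Kq κ : ℤ) := by exact_mod_cast Neg.one_le_Kq κ
  have hKu : u₁A κ Φ t p D (gT mk gx κ Φ t p D) (fT mk fx κ Φ t p D) ≤ (Neg.Kq κ : ℤ) * u₁A κ Φ t p D (gT mk gx κ Φ t p D) (fT mk fx κ Φ t p D) := le_mul_of_one_le_left (by linarith [(units_eqA κ Φ t p D (gT mk gx κ Φ t p D) (fT mk fx κ Φ t p D)).2.2.2.2.2]) hKq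
  have hR0' : (0 : ℤ) ≤ ((KS0.R'0 κ Φ t p D mk) : ℤ) := by positivity
  have hs1' : 6 * ((KS0.R'0 κ Φ t p D mk) : ℤ) + 11 ≤ u₁A κ Φ t p D (gT mk gx κ Φ t p D) (fT mk fx κ Φ t p D) := by linarith
  have hu2 : 2 ≤ u₁A κ Φ t p D (gT mk gx κ Φ t p D) (fT mk fx κ Φ t p D) := by linarith
  have hu3 : 3 ≤ u₁A κ Φ t p D (gT mk gx κ Φ t p D) (fT mk fx κ Φ t p D) := by linarith
  have hu11 : 11 ≤ u₀A κ Φ t p D (gT mk gx κ Φ t p D) (fT mk fx κ Φ t p D) := by linarith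
  -- the origin `o := yLXFs σ`
  obtain ⟨hΛ₀, hΛ₁⟩ := Λ_yLXFs κ Φ t p D c mk (fT mk fx κ Φ t p D) gx hN hκ hS hMR0 hσ
  have he0' : |FcA κ Φ t p D (gT mk gx κ Φ t p D) (fT mk fx κ Φ t p D) (yLXFs κ Φ t p D c mk (gT mk gx κ Φ t p D) (fT mk fx κ Φ t p D) (sgOf du))| ≤ 3 * u₀A κ Φ t p D (gT mk gx κ Φ t p D) (fT mk fx κ Φ t p D) := abs_FcA_le_of_Λ₀ κ Φ t p D (gT mk gx κ Φ t p D) (fT mk fx κ Φ t p D) hN (yLXFs κ Φ t p D c mk (gT mk gx κ Φ t p D) (fT mk fx κ Φ t p D) (sgOf du)) hΛ₀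
  have he0 : |FcA κ Φ t p D (gT mk gx κ Φ t p D) (fT mk fx κ Φ t p D) (yLXFs κ Φ t p D c mk (gT mk gx κ Φ t p D) (fT mk fx κ Φ t p D) (sgOf du))| ≤ 5 * u₀A κ Φ t p D (gT mk gx κ Φ t p D) (fT mk fx κ Φ t p D) := he0'.trans (by linarith [(units_eqA κ Φ t p D (gT mk gx κ Φ t p D) (fT mk fx κ Φ t p D)).2.2.2.2.1])
  have he1 : |F1cA κ Φ t p D (gT mk gx κ Φ t p D) (fT mk fx κ Φ t p D) (yLXFs κ Φ t p D c mk (gT mk gx κ Φ t p D) (fT mk fx κ Φ t p D) (sgOf du))| ≤ 2 * u₁A κ Φ t p D (gT mk gx κ Φ t p D) (fT mk fx κ Φ t p D) := abs_F1cA_le_of_Λ₁ κ Φ t p D (gT mk gx κ Φ t p D) (fT mk fx κ Φ t p D) hN (yLXFs κ Φ t p D c mk (gT mk gx κ Φ t p D) (fT mk fx κ Φ t p D) (sgOf du)) hΛ₁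
  have hyl := yLXFs_l1 κ Φ t p D c mk gx fx hσ
  -- the prefix count's range, read at `yTX0 o σ`
  have hdx := FcA_yTX0_sub_abs_le κ Φ t p D (gT mk gx κ Φ t p D) (fT mk fx κ Φ t p D) hN (yLXFs κ Φ t p D c mk (gT mk gx κ Φ t p D) (fT mk fx κ Φ t p D) (sgOf du)) hσ
  have hC0 : |FcA κ Φ t p D (gT mk gx κ Φ t p D) (fT mk fx κ Φ t p D) (yTX0 κ Φ t p D (gT mk gx κ Φ t p D) (fT mk fx κ Φ t p D) (yLXFs κ Φ t p D c mk (gT mk gx κ Φ t p D) (fT mk fx κ Φ t p D) (sgOf du)) (sgOf du))| ≤ 6 * u₀A κ Φ t p D (gT mk gx κ Φ t p D) (fT mk fx κ Φ t p D) + 2 := by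
    have := abs_sub_abs_le_abs_sub (FcA κ Φ t p D (gT mk gx κ Φ t p D) (fT mk fx κ Φ t p D) (yTX0 κ Φ t p D (gT mk gx κ Φ t p D) (fT mk fx κ Φ t p D) (yLXFs κ Φ t p D c mk (gT mk gx κ Φ t p D) (fT mk fx κ Φ t p D) (sgOf du)) (sgOf du))) (FcA κ Φ t p D (gT mk gx κ Φ t p D) (fT mk fx κ Φ t p D) (yLXFs κ Φ t p D c mk (gT mk gx κ Φ t p D) (fT mk fx κ Φ t p D) (sgOf du))); linarith
  have hbw2 := (bwY_eq κ Φ t p D (gT mk gx κ Φ t p D) (fT mk fx κ Φ t p D)).2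
  have hF : FcA κ Φ t p D (gT mk gx κ Φ t p D) (fT mk fx κ Φ t p D) (yTX0 κ Φ t p D (gT mk gx κ Φ t p D) (fT mk fx κ Φ t p D) (yLXFs κ Φ t p D c mk (gT mk gx κ Φ t p D) (fT mk fx κ Φ t p D) (sgOf du)) (sgOf du)) + u₀A κ Φ t p D (gT mk gx κ Φ t p D) (fT mk fx κ Φ t p D) ≤ T0Y P.toPCells2T x du z + ((bwY κ Φ t p D (gT mk gx κ Φ t p D) (fT mk fx κ Φ t p D)) : ℤ) := by
    have := (abs_le.1 hC0).2; linarith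
  have hNx := NxW_range κ Φ t p D (gT mk gx κ Φ t p D) (fT mk fx κ Φ t p D) P.toPCells2T hP' (yLXFs κ Φ t p D c mk (gT mk gx κ Φ t p D) (fT mk fx κ Φ t p D) (sgOf du)) x du hd z hz hkE hC0 (by linarith) hbw2 hF
  -- the junction
  have he1T := (juncYx_F1cA κ Φ t p D (gT mk gx κ Φ t p D) (fT mk fx κ Φ t p D) hN P.toPCells2T (yLXFs κ Φ t p D c mk (gT mk gx κ Φ t p D) (fT mk fx κ Φ t p D) (sgOf du)) x du z (bwY κ Φ t p D (gT mk gx κ Φ t p D) (fT mk fx κ Φ t p D)) he1).2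
  obtain ⟨hX, hNy⟩ := NrY_range κ Φ t p D (gT mk gx κ Φ t p D) (fT mk fx κ Φ t p D) P.toPCells2T hP' x du hd z hj hlev1 hlev2 (yTYx κ Φ t p D (gT mk gx κ Φ t p D) (fT mk fx κ Φ t p D) P.toPCells2T (yLXFs κ Φ t p D c mk (gT mk gx κ Φ t p D) (fT mk fx κ Φ t p D) (sgOf du)) x du z (bwY κ Φ t p D (gT mk gx κ Φ t p D) (fT mk fx κ Φ t p D))) he1T (by linarith)
  have hk600 : ∀ k ≤ (NrY κ Φ t p D (gT mk gx κ Φ t p D) (fT mk fx κ Φ t p D) P.toPCells2T (yTYx κ Φ t p D (gT mk gx κ Φ t p D) (fT mk fx κ Φ t p D) P.toPCells2T (yLXFs κ Φ t p D c mk (gT mk gx κ Φ t p D) (fT mk fx κ Φ t p D) (sgOf du)) x du z (bwY κ Φ t p D (gT mk gx κ Φ t p D) (fT mk fx κ Φ t p D))) x du z), k + 1 ≤ 600 * Neg.Kq κ := fun k hk => by omega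
  obtain ⟨hT1, hT1'⟩ := NrY_spec κ Φ t p D (gT mk gx κ Φ t p D) (fT mk fx κ Φ t p D) P.toPCells2T (yTYx κ Φ t p D (gT mk gx κ Φ t p D) (fT mk fx κ Φ t p D) P.toPCells2T (yLXFs κ Φ t p D c mk (gT mk gx κ Φ t p D) (fT mk fx κ Φ t p D) (sgOf du)) x du z (bwY κ Φ t p D (gT mk gx κ Φ t p D) (fT mk fx κ Φ t p D))) x du z hX
  have eσ1 : sgOf du * (T1Y P.toPCells2T x du z - F1cA κ Φ t p D (gT mk gx κ Φ t p D) (fT mk fx κ Φ t p D) (yTYx κ Φ t p D (gT mk gx κ Φ t p D) (fT mk fx κ Φ t p D) P.toPCells2T (yLXFs κ Φ t p D c mk (gT mk gx κ Φ t p D) (fT mk fx κ Φ t p D) (sgOf du)) x du z (bwY κ Φ t p D (gT mk gx κ Φ t p D) (fT mk fx κ Φ t p D)))) = T1Y P.toPCells2T x du z - F1cA κ Φ t p D (gT mk gx κ Φ t p D) (fT mk fx κ Φ t p D) (yTYx κ Φ t p D (gT mk gx κ Φ t p D) (fT mk fx κ Φ t p D) P.toPCells2T (yLXFs κ Φ t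 p D c mk (gT mk gx κ Φ t p D) (fT mk fx κ Φ t p D) (sgOf du)) x du z (bwY κ Φ t p D (gT mk gx κ Φ t p D) (fT mk fx κ Φ t p D))) := by rw [hsg, one_mul]
  rw [eσ1] at hT1'
  have hTeq := T1Y_eq P.toPCells2T x du hd z
  have eσ2 : sgOf du * T1Y P.toPCells2T x du z = T1Y P.toPCells2T x du z := by rw [hsg, one_mul]
  rw [eσ2] at hTeq
  have elev : P.lev du x z = P.toPCells2T.lev du x z := rfl
  rw [← elev] at hTeq
  obtain ⟨hfl, hjr⟩ := faceL1_eq κ Φ t p D (gT mk gx κ Φ t p D) (fT mk fx κ Φ t p D) P.toPCells2T hP' j hj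
  have htan := tanYx_pos κ Φ t p D (gT mk gx κ Φ t p D) (fT mk fx κ Φ t p D) P.toPCells2T x du hd z (yLXFs κ Φ t p D c mk (gT mk gx κ Φ t p D) (fT mk fx κ Φ t p D) (sgOf du)) hz hkE24 hu0 he0 hN (bwY κ Φ t p D (gT mk gx κ Φ t p D) (fT mk fx κ Φ t p D))
  obtain ⟨hplo, hphi⟩ := juncYx_pos κ Φ t p D (gT mk gx κ Φ t p D) (fT mk fx κ Φ t p D) hN P.toPCells2T x du hd hsg z (yLXFs κ Φ t p D c mk (gT mk gx κ Φ t p D) (fT mk fx κ Φ t p D) (sgOf du)) hz hkE24 hu0 he0 (bwY κ Φ t p D (gT mk gx κ Φ t p D) (fT mk fx κ Φ t p D))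
  obtain ⟨hwlo, hwhi⟩ := juncYx_window κ Φ t p D (gT mk gx κ Φ t p D) (fT mk fx κ Φ t p D) hN P.toPCells2T x du hsg z (yLXFs κ Φ t p D c mk (gT mk gx κ Φ t p D) (fT mk fx κ Φ t p D) (sgOf du)) he0 hu11 hTwx
  obtain ⟨hLlo, hLhi⟩ := juncYx_levelwin κ Φ t p D (gT mk gx κ Φ t p D) (fT mk fx κ Φ t p D) hN P.toPCells2T x du hsg z (yLXFs κ Φ t p D c mk (gT mk gx κ Φ t p D) (fT mk fx κ Φ t p D) (sgOf du)) (bwY κ Φ t p D (gT mk gx κ Φ t p D) (fT mk fx κ Φ t p D)) hX hu3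
  have hbwY := (bwY_eq κ Φ t p D (gT mk gx κ Φ t p D) (fT mk fx κ Φ t p D)).1
  -- the second run's budget rows
  have hNyR : ((((NrY κ Φ t p D (gT mk gx κ Φ t p D) (fT mk fx κ Φ t p D) P.toPCells2T (yTYx κ Φ t p D (gT mk gx κ Φ t p D) (fT mk fx κ Φ t p D) P.toPCells2T (yLXFs κ Φ t p D c mk (gT mk gx κ Φ t p D) (fT mk fx κ Φ t p D) (sgOf du)) x du z (bwY κ Φ t p D (gT mk gx κ Φ t p D) (fT mk fx κ Φ t p D))) x du z) + 1 : ℕ) : ℤ)) * ((KS0.R'0 κ Φ t p D mk) : ℤ) ≤ nL κ Φ t p D (gT mk gx κ Φ t p D) (fT mk fx κ Φ t p D) := by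
    have h1 : ((((NrY κ Φ t p D (gT mk gx κ Φ t p D) (fT mk fx κ Φ t p D) P.toPCells2T (yTYx κ Φ t p D (gT mk gx κ Φ t p D) (fT mk fx κ Φ t p D) P.toPCells2T (yLXFs κ Φ t p D c mk (gT mk gx κ Φ t p D) (fT mk fx κ Φ t p D) (sgOf du)) x du z (bwY κ Φ t p D (gT mk gx κ Φ t p D) (fT mk fx κ Φ t p D))) x du z) + 1 : ℕ) : ℤ)) ≤ 600 * (Neg.Kq κ : ℤ) := by exact_mod_cast hNy
    have h2 : 2000 * (Neg.Kq κ : ℤ) * (((KS0.R'0 κ Φ t p D mk) : ℤ) + 2) ≤ (nL κ Φ t p D (gT mk gx κ Φ t p D) (fT mk fx κ Φ t p D) : ℤ) := by exact_mod_cast hnA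
    nlinarith
  have hNyℓ : 11 * (2 * ((((NrY κ Φ t p D (gT mk gx κ Φ t p D) (fT mk fx κ Φ t p D) P.toPCells2T (yTYx κ Φ t p D (gT mk gx κ Φ t p D) (fT mk fx κ Φ t p D) P.toPCells2T (yLXFs κ Φ t p D c mk (gT mk gx κ Φ t p D) (fT mk fx κ Φ t p D) (sgOf du)) x du z (bwY κ Φ t p D (gT mk gx κ Φ t p D) (fT mk fx κ Φ t p D))) x du z) + 1 : ℕ) : ℤ)) + (((((NrY κ Φ t p D (gT mk gx κ Φ t p D) (fT mk fx κ Φ t p D) P.toPCells2T (yTYx κ Φ t p D (gT mk gx κ Φ t p D) (fT mk fx κ Φ t p D) P.toPCells2T (yLXFs κ Φ t p D c mk (gT mk gx κ Φ t p D) (fT mk fx κ Φ t p D) (sgOf du)) x du z (bwY κ Φ t p D (gT mk gx κ Φ t p D) (fT mk fx κ Φ t p D))) x du z) + 1 : ℕ) : ℤ)) + 1000 * Neg.Kq κ) * ((KS0.R'0 κ Φ t p D mk) : ℤ) + 8) ≤ 2 * (ℓL κ Φ t p D (gT mk gx κ Φ t p D) (fT mk fx κ Φ t p D) : ℤ) :=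 by
    have h1 : ((((NrY κ Φ t p D (gT mk gx κ Φ t p D) (fT mk fx κ Φ t p D) P.toPCells2T (yTYx κ Φ t p D (gT mk gx κ Φ t p D) (fT mk fx κ Φ t p D) P.toPCells2T (yLXFs κ Φ t p D c mk (gT mk gx κ Φ t p D) (fT mk fx κ Φ t p D) (sgOf du)) x du z (bwY κ Φ t p D (gT mk gx κ Φ t p D) (fT mk fx κ Φ t p D))) x du z) + 1 : ℕ) : ℤ)) ≤ 600 * (Neg.Kq κ : ℤ) := by exact_mod_cast hNy
    have h2 : 22000 * (Neg.Kq κ : ℤ) * (((KS0.R'0 κ Φ t p D mk) : ℤ) + 2) ≤ (ℓL κ Φ t p D (gT mk gx κ Φ t p D) (fT mk fx κ Φ t p D) : ℤ) := by exact_mod_cast hℓA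
    nlinarith
  refine ⟨?_, ?_, ?_, ?_, ?_, ?_, ?_, ?_, ?_, ?_, ?_, ?_, ?_, ?_, ?_, ?_, ?_, ?_, ?_, ?_, ?_, ?_, ?_, ?_, ?_, ?_⟩
  · exact hfR_YA κ Φ t p D c mk (gT mk gx κ Φ t p D) (fT mk fx κ Φ t p D) P.toPCells2T hP' x du hd j (by exact hj) z (by rw [hd]; exact hlev1) (by rw [hd]; exact hlev2) hz hEu hkF0 hkF1 hs1 hkE8
  · exact hZfar_YW κ Φ t p D c mk (gT mk gx κ Φ t p D) (fT mk fx κ Φ t p D) P.toPCells2T hP' x du hd j hj z (by rw [hd]; exact hlev2) hEu hkF1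
  · intro hσ1 k hk; rw [hd]; try rw [es1]
    exact (floorsFX_Yx κ Φ t p D (gT mk gx κ Φ t p D) (fT mk fx κ Φ t p D) mk P.toPCells2T hP' hN hκ hnA hℓA hs1' x du j hj z hlev1 hlev2 hE2 (yLXFs κ Φ t p D c mk (gT mk gx κ Φ t p D) (fT mk fx κ Φ t p D) (sgOf du)) he1 hsg hNx htan).1 hσ1 k hk
  · intro hσ1 k hk; rw [hd]; try rw [es1]
    exact (floorsFX_Yx κ Φ t p D (gT mk gx κ Φ t p D) (fT mk fx κ Φ t p D) mk P.toPCells2T hP' hN hκ hnA hℓA hs1' x du j hj z hlev1 hlev2 hE2 (yLXFs κ Φ t p D c mk (gT mk gx κ Φ t p D) (fT mk fx κ Φ t p D) (sgOf du)) he1 hsg hNx htan).2.1 hσ1 k hk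
  · exact fun h => absurd h hm1'
  · exact fun h => absurd h hm1'
  · intro k hk; rw [hd]; try rw [es0]
    exact (floorsFX_Yx κ Φ t p D (gT mk gx κ Φ t p D) (fT mk fx κ Φ t p D) mk P.toPCells2T hP' hN hκ hnA hℓA hs1' x du j hj z hlev1 hlev2 hE2 (yLXFs κ Φ t p D c mk (gT mk gx κ Φ t p D) (fT mk fx κ Φ t p D) (sgOf du)) he1 hsg hNx htan).2.2.2.2.1 k hk
  · intro k hk; rw [hd]; try rw [es0]
    exact (floorsFX_Yx κ Φ t p D (gT mk gx κ Φ t p D) (fT mk fx κ Φ t p D) mk P.toPCells2T hP' hN hκ hnA hℓA hs1' x du j hj z hlev1 hlev2 hE2 (yLXFs κ Φ t p D c mk (gT mk gx κ Φ t p D) (fT mk fx κ Φ t p D) (sgOf du)) he1 hsg hNx htan).2.2.2.2.2 k hk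
  · -- FY1: the near end above `flo`
    intro _ k hk; rw [hd]; try rw [es1]
    refine FYlo_Yx κ Φ t p D (gT mk gx κ Φ t p D) (fT mk fx κ Φ t p D) mk hN hκ hℓA (yTYx κ Φ t p D (gT mk gx κ Φ t p D) (fT mk fx κ Φ t p D) P.toPCells2T (yLXFs κ Φ t p D c mk (gT mk gx κ Φ t p D) (fT mk fx κ Φ t p D) (sgOf du)) x du z (bwY κ Φ t p D (gT mk gx κ Φ t p D) (fT mk fx κ Φ t p D))) (hk600 k hk) ?_
    have e2 := (abs_le.1 he1T).1
    have hk0 : 0 ≤ 1 * u₁A κ Φ t p D (gT mk gx κ Φ t p D) (fT mk fx κ Φ t p D) * (k : ℤ) := by positivity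
    have hlev_lo : 5 * (P.r 1 : ℤ) + 10 * u₁A κ Φ t p D (gT mk gx κ Φ t p D) (fT mk fx κ Φ t p D) * ((j : ℤ) + 1) - 1 - E ≤ P.lev du x z := by rw [← hfl]; exact hlev1
    linarith
  · -- FY2: the far end below `fhi`
    intro _ k hk; rw [hd]; try rw [es1]
    refine FYhi_Yx κ Φ t p D (gT mk gx κ Φ t p D) (fT mk fx κ Φ t p D) mk hN hκ hℓA (yTYx κ Φ t p D (gT mk gx κ Φ t p D) (fT mk fx κ Φ t p D) P.toPCells2T (yLXFs κ Φ t p D c mk (gT mk gx κ Φ t p D) (fT mk fx κ Φ t p D) (sgOf du)) x du z (bwY κ Φ t p D (gT mk gx κ Φ t p D) (fT mk fx κ Φ t p D))) (hk600 k hk) ?_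
    have hk' : (k : ℤ) ≤ ((NrY κ Φ t p D (gT mk gx κ Φ t p D) (fT mk fx κ Φ t p D) P.toPCells2T (yTYx κ Φ t p D (gT mk gx κ Φ t p D) (fT mk fx κ Φ t p D) P.toPCells2T (yLXFs κ Φ t p D c mk (gT mk gx κ Φ t p D) (fT mk fx κ Φ t p D) (sgOf du)) x du z (bwY κ Φ t p D (gT mk gx κ Φ t p D) (fT mk fx κ Φ t p D))) x du z) : ℤ) := by exact_mod_cast hk
    have hku : 1 * u₁A κ Φ t p D (gT mk gx κ Φ t p D) (fT mk fx κ Φ t p D) * (k : ℤ) ≤ u₁A κ Φ t p D (gT mk gx κ Φ t p D) (fT mk fx κ Φ t p D) * ((NrY κ Φ t p D (gT mk gx κ Φ t p D) (fT mk fx κ Φ t p D) P.toPCells2T (yTYx κ Φ t p D (gT mk gx κ Φ t p D) (fT mk fx κ Φ t p D) P.toPCells2T (yLXFs κ Φ t p D c mk (gT mk gx κ Φ t p D) (fT mk fx κ Φ t p D) (sgOf du)) x du z (bwY κ Φ t p D (gT mk gx κ Φ t p D) (fT mk fx κ Φ t p D))) x du z) : ℤ) := by nlinarith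
    have hNu : u₁A κ Φ t p D (gT mk gx κ Φ t p D) (fT mk fx κ Φ t p D) * ((NrY κ Φ t p D (gT mk gx κ Φ t p D) (fT mk fx κ Φ t p D) P.toPCells2T (yTYx κ Φ t p D (gT mk gx κ Φ t p D) (fT mk fx κ Φ t p D) P.toPCells2T (yLXFs κ Φ t p D c mk (gT mk gx κ Φ t p D) (fT mk fx κ Φ t p D) (sgOf du)) x du z (bwY κ Φ t p D (gT mk gx κ Φ t p D) (fT mk fx κ Φ t p D))) x du z : ℤ) + 1) =
        u₁A κ Φ t p D (gT mk gx κ Φ t p D) (fT mk fx κ Φ t p D) * (NrY κ Φ t p D (gT mk gx κ Φ t p D) (fT mk fx κ Φ t p D) P.toPCells2T (yTYx κ Φ t p D (gT mk gx κ Φ t p D) (fT mk fx κ Φ t p D) P.toPCells2T (yLXFs κ Φ t p D c mk (gT mk gx κ Φ t p D) (fT mk fx κ Φ t p D) (sgOf du)) x du z (bwY κ Φ t p D (gT mk gx κ Φ t p D) (fT mk fx κ Φ t p D))) x du z : ℤ) + u₁A κ Φ t p D (gT mk gx κ Φ t p D) (fT mk fx κ Φ t p D) := by ring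
    linarith [hNu, hT1', hTeq, hku, hr1, hKu, hu1]
  · exact fun h => absurd h hm1'
  · exact fun h => absurd h hm1'
  · intro k hk; rw [hd]
    exact FWlo_Yx κ Φ t p D (gT mk gx κ Φ t p D) (fT mk fx κ Φ t p D) mk hN hκ hnA24 hℓA (yTYx κ Φ t p D (gT mk gx κ Φ t p D) (fT mk fx κ Φ t p D) P.toPCells2T (yLXFs κ Φ t p D c mk (gT mk gx κ Φ t p D) (fT mk fx κ Φ t p D) (sgOf du)) x du z (bwY κ Φ t p D (gT mk gx κ Φ t p D) (fT mk fx κ Φ t p D))) (hk600 k hk) hplo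
  · intro k hk; rw [hd]
    exact FWhi_Yx κ Φ t p D (gT mk gx κ Φ t p D) (fT mk fx κ Φ t p D) mk hN hκ hnA24 hℓA (yTYx κ Φ t p D (gT mk gx κ Φ t p D) (fT mk fx κ Φ t p D) P.toPCells2T (yLXFs κ Φ t p D c mk (gT mk gx κ Φ t p D) (fT mk fx κ Φ t p D) (sgOf du)) x du z (bwY κ Φ t p D (gT mk gx κ Φ t p D) (fT mk fx κ Φ t p D))) (hk600 k hk) hphi
  · refine FL1_Yx κ Φ t p D (gT mk gx κ Φ t p D) (fT mk fx κ Φ t p D) mk P.toPCells2T hN hκ x du z (yTYx κ Φ t p D (gT mk gx κ Φ t p D) (fT mk fx κ Φ t p D) P.toPCells2T (yLXFs κ Φ t p D c mk (gT mk gx κ Φ t p D) (fT mk fx κ Φ t p D) (sgOf du)) x du z (bwY κ Φ t p D (gT mk gx κ Φ t p D) (fT mk fx κ Φ t p D))) hNyR hNyℓ ?_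
    linarith
  · exact FL2_Yx κ Φ t p D (gT mk gx κ Φ t p D) (fT mk fx κ Φ t p D) mk P.toPCells2T hN hκ x du z (yTYx κ Φ t p D (gT mk gx κ Φ t p D) (fT mk fx κ Φ t p D) P.toPCells2T (yLXFs κ Φ t p D c mk (gT mk gx κ Φ t p D) (fT mk fx κ Φ t p D) (sgOf du)) x du z (bwY κ Φ t p D (gT mk gx κ Φ t p D) (fT mk fx κ Φ t p D))) hNyR hNyℓ hwhi
  · have h := FL3_XW κ Φ t p D (gT mk gx κ Φ t p D) (fT mk fx κ Φ t p D) mk P.toPCells2T hN hκ hu2 x du z (yLXFs κ Φ t p D c mk (gT mk gx κ Φ t p D) (fT mk fx κ Φ t p D) (sgOf du)) (sgOf du) (NxW κ Φ t p D (gT mk gx κ Φ t p D) (fT mk fx κ Φ t p D) P.toPCells2T (yLXFs κ Φ t p D c mk (gT mk gx κ Φ t p D) (fT mk fx κ Φ t p D) (sgOf du)) x du z (bwY κ Φ t p D (gT mk gx κ Φ t p D) (fT mk fx κ Φ t p D))) hLlo hNyℓ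
    rw [hsg] at h ⊢; exact h
  · have h := FL4_XW κ Φ t p D (gT mk gx κ Φ t p D) (fT mk fx κ Φ t p D) mk P.toPCells2T hN hκ hu2 x du z (yLXFs κ Φ t p D c mk (gT mk gx κ Φ t p D) (fT mk fx κ Φ t p D) (sgOf du)) (sgOf du) (NxW κ Φ t p D (gT mk gx κ Φ t p D) (fT mk fx κ Φ t p D) P.toPCells2T (yLXFs κ Φ t p D c mk (gT mk gx κ Φ t p D) (fT mk fx κ Φ t p D) (sgOf du)) x du z (bwY κ Φ t p D (gT mk gx κ Φ t p D) (fT mk fx κ Φ t p D))) hLhi hNyℓ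
    rw [hsg] at h ⊢; exact h
  · exact hfit_Yx κ Φ t p D mk (gT mk gx κ Φ t p D) (fT mk fx κ Φ t p D) P.toPCells2T hnA (yLXFs κ Φ t p D c mk (gT mk gx κ Φ t p D) (fT mk fx κ Φ t p D) (sgOf du)) x du z (bwY κ Φ t p D (gT mk gx κ Φ t p D) (fT mk fx κ Φ t p D)) hNx
  · exact hq₃_Yx κ Φ t p D mk (gT mk gx κ Φ t p D) (fT mk fx κ Φ t p D) P.toPCells2T (yLXFs κ Φ t p D c mk (gT mk gx κ Φ t p D) (fT mk fx κ Φ t p D) (sgOf du)) x du z (bwY κ Φ t p D (gT mk gx κ Φ t p D) (fT mk fx κ Φ t p D)) hNx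
  · exact hxaXF_s κ Φ t p D c mk (gT mk gx κ Φ t p D) (fT mk fx κ Φ t p D) hσ
  · exact hxbXF_s κ Φ t p D c mk gx fx hN hκ hS hMR0 hσ
  · exact hclr_Yx κ Φ t p D c mk (gT mk gx κ Φ t p D) (fT mk fx κ Φ t p D) hRn0 du (NxW κ Φ t p D (gT mk gx κ Φ t p D) (fT mk fx κ Φ t p D) P.toPCells2T (yLXFs κ Φ t p D c mk (gT mk gx κ Φ t p D) (fT mk fx κ Φ t p D) (sgOf du)) x du z (bwY κ Φ t p D (gT mk gx κ Φ t p D) (fT mk fx κ Φ t p D)))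
  · exact clr₃_Yx κ Φ t p D (gT mk gx κ Φ t p D) (fT mk fx κ Φ t p D) c mk P.toPCells2T hN hκ hℓA hS64 hc x du hsg z (bwY κ Φ t p D (gT mk gx κ Φ t p D) (fT mk fx κ Φ t p D)) hNy
  · exact hπ2_Yx κ Φ t p D c mk (gT mk gx κ Φ t p D) (fT mk fx κ Φ t p D) P.toPCells2T x du z (bwY κ Φ t p D (gT mk gx κ Φ t p D) (fT mk fx κ Φ t p D)) (yLXFs κ Φ t p D c mk (gT mk gx κ Φ t p D) (fT mk fx κ Φ t p D) (sgOf du)) hNx hyl r hr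
  · exact hπ3_Yx κ Φ t p D c mk (gT mk gx κ Φ t p D) (fT mk fx κ Φ t p D) P.toPCells2T hN hκ hℓA x du z (bwY κ Φ t p D (gT mk gx κ Φ t p D) (fT mk fx κ Φ t p D)) (yLXFs κ Φ t p D c mk (gT mk gx κ Φ t p D) (fT mk fx κ Φ t p D) (sgOf du)) hσ hNy hNx hyl r hr

end KS

end NegB

end PlanarSkeletonFrmFrom

end Summit.CriticalPhenomena.PercolationContinuityZ3.Theorems.Transplant

end
-- build-touch 2026-08-25T15:42Z T1-D (lead g18): re-land of p398093, declarations byte-identical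
-- build-touch 2026-08-25T18:55Z T1-D (lead g18) 2nd touch (90-min clause): re-land of p401737, declarations byte-identical
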